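import Literature.Analysis.FunctionSpaces.TorusDerivBounds
import HarnessLib

/-!
# The analyticity seminorms `⟦f⟧_{n,R}` of Armstrong–Vicol on the flat torus, and the product estimate

Analysis/FunctionSpaces file (two definitions with unfolding API; every statement proved; no named
facts). Armstrong–Vicol (*Anomalous diffusion by fractal homogenization*, Ann. PDE 11 (2025) =
arXiv:2305.05048, Appendix A "Faà di Bruno formula and its consequences", (A.1) = (e.barf), p. 70)
measure quantitative analyticity of a periodic function by the family of seminorms

  `⟦f⟧_{n,R} := (n+1)² / (n! Rⁿ) · sup_{|α| = n} ‖∂^α f‖_{L^∞}`,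

so that "`⟦f⟧_{n,R} ≤ C` for all `n`" says: every `n`-th derivative is bounded by `C n! Rⁿ/(n+1)²`
(radius of analyticity `≳ 1/R`; the shift `(n+1)²` makes the class stable under products and
composition with universal constants, App. A Lemma 7.1 / Prop. 7.6 / Lemma 7.7 in the arXiv numbering).
This file vendors the seminorm over the tree's iterated partial derivatives
`Torus.iterPartialDeriv l f` (`TorusDerivBounds`; words `l : List d` of directions play the role of
multi-indices — for smooth `f` mixed partials commute, so the two suprema agree) and proves the
**product estimate** (Lemma 7.1):

* §1 `Torus.derivSup n f = sup_{|l| = n, y} ‖∂^l f y‖` with its API (read-out, intro rule, the shift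
  `derivSup k (∂ᵢf) ≤ derivSup (k+1) f`);
* §2 `Torus.dnorm n R f = (n+1)²/(n! Rⁿ) · derivSup n f` = `⟦f⟧_{n,R}`, read-out / intro rules and the
  bridge from the geometric class `Torus.HasDerivBounds`;
* §3 the binomial Leibniz bound `‖∂^l(fg)‖ ≤ Σₖ C(n,k) derivSup k f · derivSup (n−k) g`;
* §4 `Torus.dnorm_mul_le_sum`: `⟦fg⟧_{n,R} ≤ C_f C_g Σₖ (n+1)²/((k+1)²(n−k+1)²)` given `⟦f⟧_{j,R} ≤ C_f`,
  `⟦g⟧_{j,R} ≤ C_g` for `j ≤ n` (the displayed inequality of the proof of Lemma 7.1), and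
  `Torus.dnorm_mul_le`: `⟦fg⟧_{n,R} ≤ 8 C_f C_g` (Armstrong–Vicol state the sharper universal constant
  `4`, the numerical supremum of the sum being `≈ 3.52`; we prove the elementary bound `8`, which is
  all that stability under products requires).

Consumer: the analytic frame tower S1″ of the K1L one-level split (cell `ad-ideate`, F-lead-3): the
composition and flow estimates (App. A Prop. 7.6, Lemma 7.7, Cor. 7.8) are stated over `Torus.dnorm`.

## References

* S. Armstrong, V. Vicol, *Anomalous diffusion by fractal homogenization*, Ann. PDE 11 (2025),
  arXiv:2305.05048, App. A (A.1), Lemma 7.1 (arXiv numbering; product estimate). [`ArmstrongVicol2025`]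
* S. G. Krantz, H. R. Parks, *A primer of real analytic functions*, 2nd ed. (Birkhäuser 2002), §2.2
  (Prop. 2.2.10: characterisation of real analyticity by `‖∂^α f‖ ≤ C α! R^{|α|}`). [`KrantzParks2002`]
-/

noncomputable section

open Set Function Finset

namespace Literature.Analysis.FunctionSpaces

namespace Torus

variable {d : Type*} [Fintype d] [DecidableEq d]
variable {F : Type*} [NormedAddCommGroup F] [NormedSpace ℝ F]

/-! ## §1 The order-`n` derivative supremum -/

/-- **The order-`n` derivative supremum** `derivSup n f = sup { ‖∂^l f(y)‖ : |l| = n, y ∈ T^d }`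
(words of length `n` are indexed by `Fin n → d`; the supremum is `0` by convention when unbounded,
which does not happen for smooth `f`). [cite: ArmstrongVicol2025, App. A (A.1)] -/
def derivSup (n : ℕ) (f : UnitAddTorus d → F) : ℝ :=
  ⨆ w : Fin n → d, ⨆ y : UnitAddTorus d, ‖iterPartialDeriv (List.ofFn w) f y‖

omit [Fintype d] in
/-- Unfolding. [cite: ArmstrongVicol2025, App. A (A.1)] -/
theorem derivSup_def (n : ℕ) (f : UnitAddTorus d → F) :
    derivSup n f = ⨆ w : Fin n → d, ⨆ y : UnitAddTorus d, ‖iterPartialDeriv (List.ofFn w) f y‖ := rfl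

omit [Fintype d] in
/-- `derivSup n f ≥ 0`. [cite: ArmstrongVicol2025, App. A (A.1)] -/
theorem derivSup_nonneg (n : ℕ) (f : UnitAddTorus d → F) : 0 ≤ derivSup n f :=
  Real.iSup_nonneg fun _ => Real.iSup_nonneg fun _ => norm_nonneg _

omit [Fintype d] in
/-- **Intro rule**: a uniform bound of all `n`-th partials bounds `derivSup n f`. [cite: ArmstrongVicol2025, App. A (A.1)] -/
theorem derivSup_le {n : ℕ} {f : UnitAddTorus d → F} {C : ℝ} (hC : 0 ≤ C)
    (h : ∀ l : List d, l.length = n → ∀ y, ‖iterPartialDeriv l f y‖ ≤ C) : derivSup n f ≤ C :=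
  Real.iSup_le (fun _ => Real.iSup_le (fun y => h _ (List.length_ofFn) y) hC) hC

/-- **Read-out**: for smooth `f`, `‖∂^l f(y)‖ ≤ derivSup |l| f`. [cite: ArmstrongVicol2025, App. A (A.1)] -/
theorem norm_iterPartialDeriv_le_derivSup {f : UnitAddTorus d → F} (hf : IsSmooth f) (l : List d)
    (y : UnitAddTorus d) : ‖iterPartialDeriv l f y‖ ≤ derivSup l.length f := by
  have hbdd_in : ∀ w : Fin l.length → d,
      BddAbove (Set.range fun y : UnitAddTorus d => ‖iterPartialDeriv (List.ofFn w) f y‖) := fun w =>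
    (isCompact_range (hf.iterPartialDeriv (List.ofFn w)).continuous.norm).bddAbove
  have hbdd_out : BddAbove (Set.range fun w : Fin l.length → d =>
      ⨆ y : UnitAddTorus d, ‖iterPartialDeriv (List.ofFn w) f y‖) := (Set.finite_range _).bddAbove
  have h1 : ‖iterPartialDeriv l f y‖ ≤ ⨆ y' : UnitAddTorus d, ‖iterPartialDeriv (List.ofFn l.get) f y'‖ := by
    have e : List.ofFn l.get = l := List.ofFn_get l
    rw [e]
    exact le_ciSup (f := fun y' : UnitAddTorus d => ‖iterPartialDeriv l f y'‖) (e ▸ hbdd_in l.get) y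
  exact h1.trans (le_ciSup (f := fun w : Fin l.length → d =>
    ⨆ y : UnitAddTorus d, ‖iterPartialDeriv (List.ofFn w) f y‖) hbdd_out l.get)

/-- **Order shift**: `derivSup k (∂ᵢ f) ≤ derivSup (k+1) f` (`∂^l ∂ᵢ = ∂^{l i}`). [cite: ArmstrongVicol2025, App. A (A.1)] -/
theorem derivSup_partialDeriv_le {f : UnitAddTorus d → F} (hf : IsSmooth f) (i : d) (k : ℕ) :
    derivSup k (Torus.partialDeriv i f) ≤ derivSup (k + 1) f := by
  refine derivSup_le (derivSup_nonneg _ _) fun l hl y => ?_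
  rw [← iterPartialDeriv_concat]
  have h := norm_iterPartialDeriv_le_derivSup hf (l ++ [i]) y
  rwa [List.length_append, List.length_singleton, hl] at h

/-- Order zero: `‖f y‖ ≤ derivSup 0 f` for smooth `f`. [cite: ArmstrongVicol2025, App. A (A.1)] -/
theorem norm_le_derivSup_zero {f : UnitAddTorus d → F} (hf : IsSmooth f) (y : UnitAddTorus d) :
    ‖f y‖ ≤ derivSup 0 f := by
  simpa using norm_iterPartialDeriv_le_derivSup hf [] y

/-! ## §2 The analyticity seminorms `⟦f⟧_{n,R}` -/

/-- **The Armstrong–Vicol analyticity seminorm** `⟦f⟧_{n,R} = (n+1)²/(n! Rⁿ) · sup_{|l|=n} ‖∂^l f‖_∞`.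
[cite: ArmstrongVicol2025, App. A (A.1)] -/
def dnorm (n : ℕ) (R : ℝ) (f : UnitAddTorus d → F) : ℝ :=
  ((n : ℝ) + 1) ^ 2 / ((Nat.factorial n : ℝ) * R ^ n) * derivSup n f

omit [Fintype d] in
/-- Unfolding. [cite: ArmstrongVicol2025, App. A (A.1)] -/
theorem dnorm_def (n : ℕ) (R : ℝ) (f : UnitAddTorus d → F) :
    dnorm n R f = ((n : ℝ) + 1) ^ 2 / ((Nat.factorial n : ℝ) * R ^ n) * derivSup n f := rfl

omit [Fintype d] in
/-- `⟦f⟧_{n,R} ≥ 0` for `R ≥ 0`. [cite: ArmstrongVicol2025, App. A (A.1)] -/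
theorem dnorm_nonneg (n : ℕ) {R : ℝ} (hR : 0 ≤ R) (f : UnitAddTorus d → F) : 0 ≤ dnorm n R f :=
  mul_nonneg (div_nonneg (sq_nonneg _) (mul_nonneg (Nat.cast_nonneg _) (pow_nonneg hR _))) (derivSup_nonneg _ _)

/-- The weight `(n+1)²/(n! Rⁿ)` is positive for `R > 0`. [cite: ArmstrongVicol2025, App. A (A.1)] -/
theorem dnorm_weight_pos (n : ℕ) {R : ℝ} (hR : 0 < R) :
    0 < ((n : ℝ) + 1) ^ 2 / ((Nat.factorial n : ℝ) * R ^ n) :=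
  div_pos (by positivity) (mul_pos (by exact_mod_cast Nat.factorial_pos n) (pow_pos hR _))

/-- **Read-out**: `⟦f⟧_{n,R} ≤ C` gives `‖∂^l f(y)‖ ≤ C n! Rⁿ/(n+1)²` for every word of length `n`.
[cite: ArmstrongVicol2025, App. A (A.1)] -/
theorem norm_iterPartialDeriv_le_of_dnorm_le {n : ℕ} {R C : ℝ} {f : UnitAddTorus d → F} (hf : IsSmooth f)
    (hR : 0 < R) (h : dnorm n R f ≤ C) {l : List d} (hl : l.length = n) (y : UnitAddTorus d) :
    ‖iterPartialDeriv l f y‖ ≤ C * ((Nat.factorial n : ℝ) * R ^ n) / ((n : ℝ) + 1) ^ 2 := by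
  have hw := dnorm_weight_pos n hR
  have hD : derivSup n f ≤ C * ((Nat.factorial n : ℝ) * R ^ n) / ((n : ℝ) + 1) ^ 2 := by
    rw [dnorm_def] at h
    have h1 : derivSup n f ≤ C / (((n : ℝ) + 1) ^ 2 / ((Nat.factorial n : ℝ) * R ^ n)) := by
      rw [le_div_iff₀ hw, mul_comm]
      exact h
    rwa [div_div_eq_mul_div] at h1
  exact (hl ▸ norm_iterPartialDeriv_le_derivSup hf l y).trans hD

omit [Fintype d] in
/-- **Intro rule**: `‖∂^l f‖ ≤ C n! Rⁿ/(n+1)²` for all words of length `n` gives `⟦f⟧_{n,R} ≤ C`.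
[cite: ArmstrongVicol2025, App. A (A.1)] -/
theorem dnorm_le_of_forall_norm_iterPartialDeriv_le {n : ℕ} {R C : ℝ} {f : UnitAddTorus d → F}
    (hR : 0 < R) (hC : 0 ≤ C)
    (h : ∀ l : List d, l.length = n → ∀ y,
      ‖iterPartialDeriv l f y‖ ≤ C * ((Nat.factorial n : ℝ) * R ^ n) / ((n : ℝ) + 1) ^ 2) :
    dnorm n R f ≤ C := by
  have hw := dnorm_weight_pos n hR
  have hD : derivSup n f ≤ C * ((Nat.factorial n : ℝ) * R ^ n) / ((n : ℝ) + 1) ^ 2 :=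
    derivSup_le (by positivity) h
  rw [dnorm_def]
  calc ((n : ℝ) + 1) ^ 2 / ((Nat.factorial n : ℝ) * R ^ n) * derivSup n f
      ≤ ((n : ℝ) + 1) ^ 2 / ((Nat.factorial n : ℝ) * R ^ n) *
          (C * ((Nat.factorial n : ℝ) * R ^ n) / ((n : ℝ) + 1) ^ 2) := mul_le_mul_of_nonneg_left hD hw.le
    _ = C := by field_simp

/-- **Bridge from the geometric class**: `HasDerivBounds n f C L` (`‖∂^l f‖ ≤ C L^{|l|}`, `|l| ≤ n`)
gives `⟦f⟧_{k,R} ≤ C (k+1)² (L/R)^k / k!` for `k ≤ n`. [cite: ArmstrongVicol2025, App. A (A.1)] -/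
theorem HasDerivBounds.dnorm_le {n : ℕ} {f : UnitAddTorus d → F} {C L R : ℝ} (h : HasDerivBounds n f C L)
    (hL : 0 ≤ L) (hR : 0 < R) {k : ℕ} (hk : k ≤ n) :
    dnorm k R f ≤ C * ((k : ℝ) + 1) ^ 2 * (L / R) ^ k / (Nat.factorial k : ℝ) := by
  have hC := h.nonneg
  have hD : derivSup k f ≤ C * L ^ k :=
    derivSup_le (mul_nonneg hC (pow_nonneg hL _)) fun l hl y => by simpa [hl] using h.bound (l := l) (hl ▸ hk) y
  rw [dnorm_def]
  calc ((k : ℝ) + 1) ^ 2 / ((Nat.factorial k : ℝ) * R ^ k) * derivSup k f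
      ≤ ((k : ℝ) + 1) ^ 2 / ((Nat.factorial k : ℝ) * R ^ k) * (C * L ^ k) :=
        mul_le_mul_of_nonneg_left hD (dnorm_weight_pos k hR).le
    _ = C * ((k : ℝ) + 1) ^ 2 * (L / R) ^ k / (Nat.factorial k : ℝ) := by
        rw [div_pow]
        field_simp

omit [Fintype d] in
/-- **Monotonicity in the radius parameter**: `R ≤ R'` gives `⟦f⟧_{n,R'} ≤ ⟦f⟧_{n,R}` (`R > 0`).
[cite: ArmstrongVicol2025, App. A (A.1)] -/
theorem dnorm_anti_radius (n : ℕ) {R R' : ℝ} (hR : 0 < R) (hRR' : R ≤ R') (f : UnitAddTorus d → F) :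
    dnorm n R' f ≤ dnorm n R f := by
  rw [dnorm_def, dnorm_def]
  refine mul_le_mul_of_nonneg_right ?_ (derivSup_nonneg _ _)
  refine div_le_div_of_nonneg_left (sq_nonneg _) (mul_pos (by exact_mod_cast Nat.factorial_pos n) (pow_pos hR _)) ?_
  exact mul_le_mul_of_nonneg_left (pow_le_pow_left₀ hR.le hRR' _) (Nat.cast_nonneg _)

/-- **Subadditivity**: `⟦f + g⟧_{n,R} ≤ ⟦f⟧_{n,R} + ⟦g⟧_{n,R}` for smooth `f`, `g` (`R > 0`).
[cite: ArmstrongVicol2025, App. A (A.1)] -/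
theorem dnorm_add_le (n : ℕ) {R : ℝ} (hR : 0 < R) {f g : UnitAddTorus d → F} (hf : IsSmooth f) (hg : IsSmooth g) :
    dnorm n R (fun y => f y + g y) ≤ dnorm n R f + dnorm n R g := by
  have hD : derivSup n (fun y => f y + g y) ≤ derivSup n f + derivSup n g := by
    refine derivSup_le (add_nonneg (derivSup_nonneg _ _) (derivSup_nonneg _ _)) fun l hl y => ?_
    rw [iterPartialDeriv_add hf hg l]
    exact (norm_add_le _ _).trans (add_le_add (hl ▸ norm_iterPartialDeriv_le_derivSup hf l y)
      (hl ▸ norm_iterPartialDeriv_le_derivSup hg l y))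
  rw [dnorm_def, dnorm_def, dnorm_def, ← mul_add]
  exact mul_le_mul_of_nonneg_left hD (dnorm_weight_pos n hR).le

/-- **Scalar multiples**: `⟦c f⟧_{n,R} ≤ |c| ⟦f⟧_{n,R}` for smooth `f` (`R > 0`). [cite: ArmstrongVicol2025, App. A (A.1)] -/
theorem dnorm_const_smul_le (n : ℕ) {R : ℝ} (hR : 0 < R) {f : UnitAddTorus d → F} (hf : IsSmooth f) (c : ℝ) :
    dnorm n R (fun y => c • f y) ≤ |c| * dnorm n R f := by
  have hD : derivSup n (fun y => c • f y) ≤ |c| * derivSup n f := by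
    refine derivSup_le (mul_nonneg (abs_nonneg c) (derivSup_nonneg _ _)) fun l hl y => ?_
    rw [iterPartialDeriv_const_smul hf c l, norm_smul, Real.norm_eq_abs]
    exact mul_le_mul_of_nonneg_left (hl ▸ norm_iterPartialDeriv_le_derivSup hf l y) (abs_nonneg c)
  rw [dnorm_def, dnorm_def]
  calc ((n : ℝ) + 1) ^ 2 / ((Nat.factorial n : ℝ) * R ^ n) * derivSup n (fun y => c • f y)
      ≤ ((n : ℝ) + 1) ^ 2 / ((Nat.factorial n : ℝ) * R ^ n) * (|c| * derivSup n f) :=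
        mul_le_mul_of_nonneg_left hD (dnorm_weight_pos n hR).le
    _ = |c| * (((n : ℝ) + 1) ^ 2 / ((Nat.factorial n : ℝ) * R ^ n) * derivSup n f) := by ring

/-- **Derivative shift**: `⟦∂ᵢ f⟧_{n,R} ≤ ((n+1)³ R/(n+2)²) · ⟦f⟧_{n+1,R}` for smooth `f` (`R > 0`)
(from `derivSup n (∂ᵢf) ≤ derivSup (n+1) f` and `(n+1)!/n! = n+1`). [cite: ArmstrongVicol2025, App. A (A.1)] -/
theorem dnorm_partialDeriv_le (n : ℕ) {R : ℝ} (hR : 0 < R) {f : UnitAddTorus d → F} (hf : IsSmooth f) (i : d) :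
    dnorm n R (Torus.partialDeriv i f) ≤ (((n : ℝ) + 1) ^ 3 * R / ((n : ℝ) + 2) ^ 2) * dnorm (n + 1) R f := by
  have hD := derivSup_partialDeriv_le hf i n
  rw [dnorm_def, dnorm_def]
  have hfn : (Nat.factorial n : ℝ) ≠ 0 := by exact_mod_cast (Nat.factorial_pos n).ne'
  have hRn : R ^ n ≠ 0 := pow_ne_zero _ hR.ne'
  have e : (((n : ℝ) + 1) ^ 3 * R / ((n : ℝ) + 2) ^ 2) *
      ((((n + 1 : ℕ) : ℝ) + 1) ^ 2 / ((Nat.factorial (n + 1) : ℝ) * R ^ (n + 1)) * derivSup (n + 1) f) =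
      ((n : ℝ) + 1) ^ 2 / ((Nat.factorial n : ℝ) * R ^ n) * derivSup (n + 1) f := by
    rw [Nat.factorial_succ, pow_succ]
    push_cast
    have h2 : ((n : ℝ) + 1 + 1) ^ 2 ≠ 0 := by positivity
    field_simp
    ring
  rw [e]
  exact mul_le_mul_of_nonneg_left hD (dnorm_weight_pos n hR).le

omit [Fintype d] in
/-- **Bridge from factorial-geometric bounds**: `‖∂^l f‖ ≤ A Kⁿ n!` for all words of length `n` (`K > 0`,
`A ≥ 0`) gives `⟦f⟧_{n,2K} ≤ (9/4) A` (since `(n+1)² 2^{-n} ≤ 9/4`): the shape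
"`θ (Ca N)^{s-1} s!`" of geometric derivative growth feeds the seminorm class with radius parameter `2K`.
[cite: ArmstrongVicol2025, App. A (A.1)] -/
theorem dnorm_le_of_factorial_bound {n : ℕ} {A K : ℝ} {f : UnitAddTorus d → F} (hA : 0 ≤ A) (hK : 0 < K)
    (h : ∀ l : List d, l.length = n → ∀ y, ‖iterPartialDeriv l f y‖ ≤ A * K ^ n * (Nat.factorial n : ℝ)) :
    dnorm n (2 * K) f ≤ 9 / 4 * A := by
  have h2K : (0 : ℝ) < 2 * K := by positivity
  refine dnorm_le_of_forall_norm_iterPartialDeriv_le h2K (by positivity) fun l hl y => (h l hl y).trans ?_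
  -- `A Kⁿ n! ≤ (9/4) A · n! (2K)ⁿ / (n+1)²`, i.e. `(n+1)² ≤ (9/4) 2ⁿ`
  have key : ((n : ℝ) + 1) ^ 2 ≤ 9 / 4 * 2 ^ n := by
    have hnat : ∀ m : ℕ, 4 * (m + 1) ^ 2 ≤ 9 * 2 ^ m := by
      intro m
      induction m with
      | zero => norm_num
      | succ m ih =>
        rcases Nat.lt_or_ge m 3 with hm | hm
        · interval_cases m <;> norm_num
        · have h4 : 4 * (m + 1 + 1) ^ 2 ≤ 2 * (4 * (m + 1) ^ 2) := by nlinarith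
          calc 4 * (m + 1 + 1) ^ 2 ≤ 2 * (4 * (m + 1) ^ 2) := h4
            _ ≤ 2 * (9 * 2 ^ m) := by omega
            _ = 9 * 2 ^ (m + 1) := by ring
    have h' : (4 : ℝ) * ((n : ℝ) + 1) ^ 2 ≤ 9 * 2 ^ n := by exact_mod_cast hnat n
    linarith
  rw [mul_pow, le_div_iff₀ (by positivity)]
  have hKn : 0 ≤ K ^ n := pow_nonneg hK.le _
  have hfa : (0 : ℝ) ≤ (Nat.factorial n : ℝ) := Nat.cast_nonneg _
  calc A * K ^ n * (Nat.factorial n : ℝ) * ((n : ℝ) + 1) ^ 2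
      ≤ A * K ^ n * (Nat.factorial n : ℝ) * (9 / 4 * 2 ^ n) :=
        mul_le_mul_of_nonneg_left key (mul_nonneg (mul_nonneg hA hKn) hfa)
    _ = 9 / 4 * A * ((Nat.factorial n : ℝ) * (2 ^ n * K ^ n)) := by ring

/-- **Read-out in factorial-geometric shape**: `⟦f⟧_{n,R} ≤ C` gives `‖∂^l f‖ ≤ C Rⁿ n!` for words of
length `n` (dropping the gain `(n+1)^{-2}`). [cite: ArmstrongVicol2025, App. A (A.1)] -/
theorem factorial_bound_of_dnorm_le {n : ℕ} {R C : ℝ} {f : UnitAddTorus d → F} (hf : IsSmooth f) (hR : 0 < R)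
    (h : dnorm n R f ≤ C) {l : List d} (hl : l.length = n) (y : UnitAddTorus d) :
    ‖iterPartialDeriv l f y‖ ≤ C * R ^ n * (Nat.factorial n : ℝ) := by
  have hC : 0 ≤ C := (dnorm_nonneg n hR.le f).trans h
  refine (norm_iterPartialDeriv_le_of_dnorm_le hf hR h hl y).trans ?_
  rw [div_le_iff₀ (by positivity)]
  have h1 : (1 : ℝ) ≤ ((n : ℝ) + 1) ^ 2 := by
    have : (1 : ℝ) ≤ (n : ℝ) + 1 := by simp
    nlinarith
  calc C * ((Nat.factorial n : ℝ) * R ^ n) = C * R ^ n * (Nat.factorial n : ℝ) * 1 := by ring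
    _ ≤ C * R ^ n * (Nat.factorial n : ℝ) * ((n : ℝ) + 1) ^ 2 :=
        mul_le_mul_of_nonneg_left h1 (mul_nonneg (mul_nonneg hC (pow_nonneg hR.le _)) (Nat.cast_nonneg _))

/-- Iterated partials commute with coordinates: `∂^l(uᵢ) = (∂^l u)ᵢ` for smooth `u : T^d → ℝ^d`.
[cite: ArmstrongVicol2025, App. A (A.1)] -/
theorem iterPartialDeriv_apply_coord {u : UnitAddTorus d → EuclideanSpace ℝ d} (hu : IsSmooth u) (i : d) :
    ∀ l : List d, iterPartialDeriv l (fun y => u y i) = fun y => iterPartialDeriv l u y i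
  | [] => rfl
  | j :: l => by
    rw [iterPartialDeriv_cons, iterPartialDeriv_cons, iterPartialDeriv_apply_coord hu i l]
    funext y
    exact partialDeriv_apply_coord ((hu.iterPartialDeriv l).isContDiff (n := 1) (by simp)) j y i

omit [DecidableEq d] in
/-- `|vᵢ| ≤ ‖v‖` in `ℝ^d`. [folklore] -/
private theorem abs_apply_le_norm₇ (v : EuclideanSpace ℝ d) (i : d) : |v i| ≤ ‖v‖ := by
  simpa using PiLp.norm_apply_le v i

/-- **Components are dominated by the vector**: `⟦uᵢ⟧_{n,R} ≤ ⟦u⟧_{n,R}` (`R ≥ 0`, smooth `u`).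
[cite: ArmstrongVicol2025, App. A (A.1)] -/
theorem dnorm_apply_le (n : ℕ) {R : ℝ} (hR : 0 ≤ R) {u : UnitAddTorus d → EuclideanSpace ℝ d} (hu : IsSmooth u)
    (i : d) : dnorm n R (fun y => u y i) ≤ dnorm n R u := by
  have hD : derivSup n (fun y => u y i) ≤ derivSup n u := by
    refine derivSup_le (derivSup_nonneg _ _) fun l hl y => ?_
    rw [iterPartialDeriv_apply_coord hu i l]
    exact (by simpa [Real.norm_eq_abs] using abs_apply_le_norm₇ (iterPartialDeriv l u y) i :
      ‖iterPartialDeriv l u y i‖ ≤ ‖iterPartialDeriv l u y‖).trans (hl ▸ norm_iterPartialDeriv_le_derivSup hu l y)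
  rw [dnorm_def, dnorm_def]
  exact mul_le_mul_of_nonneg_left hD
    (div_nonneg (sq_nonneg _) (mul_nonneg (Nat.cast_nonneg _) (pow_nonneg hR _)))

/-- **The vector is dominated by the sum of its components**: `⟦u⟧_{n,R} ≤ Σᵢ ⟦uᵢ⟧_{n,R}` (`R ≥ 0`,
smooth `u`; `‖z‖ ≤ Σᵢ |zᵢ|` in `ℝ^d`). Together with `dnorm_apply_le` this converts between the
componentwise and the Euclidean renderings of vector seminorm bounds (factor at most `d`).
[cite: ArmstrongVicol2025, App. A (A.1)] -/
theorem dnorm_le_sum_dnorm_apply (n : ℕ) {R : ℝ} (hR : 0 ≤ R) {u : UnitAddTorus d → EuclideanSpace ℝ d}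
    (hu : IsSmooth u) : dnorm n R u ≤ ∑ i, dnorm n R (fun y => u y i) := by
  have hnorm : ∀ z : EuclideanSpace ℝ d, ‖z‖ ≤ ∑ i, |z i| := fun z => by
    have h0 : 0 ≤ ∑ i, |z i| := Finset.sum_nonneg fun i _ => abs_nonneg _
    rw [EuclideanSpace.norm_eq]
    calc Real.sqrt (∑ i, ‖z i‖ ^ 2) ≤ Real.sqrt ((∑ i, |z i|) ^ 2) := by
          refine Real.sqrt_le_sqrt ?_
          rw [sq, Finset.sum_mul]
          refine Finset.sum_le_sum fun i _ => ?_
          rw [Real.norm_eq_abs, sq]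
          exact mul_le_mul_of_nonneg_left (Finset.single_le_sum (fun j _ => abs_nonneg (z j)) (Finset.mem_univ i))
            (abs_nonneg _)
      _ = ∑ i, |z i| := Real.sqrt_sq h0
  have hD : derivSup n u ≤ ∑ i, derivSup n (fun y => u y i) := by
    refine derivSup_le (Finset.sum_nonneg fun i _ => derivSup_nonneg _ _) fun l hl y => ?_
    refine (hnorm _).trans (Finset.sum_le_sum fun i _ => ?_)
    have h := hl ▸ norm_iterPartialDeriv_le_derivSup (hu.apply i) l y
    rw [iterPartialDeriv_apply_coord hu i l, Real.norm_eq_abs] at h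
    exact h
  rw [dnorm_def]
  have hw : 0 ≤ ((n : ℝ) + 1) ^ 2 / ((Nat.factorial n : ℝ) * R ^ n) :=
    div_nonneg (sq_nonneg _) (mul_nonneg (Nat.cast_nonneg _) (pow_nonneg hR _))
  calc ((n : ℝ) + 1) ^ 2 / ((Nat.factorial n : ℝ) * R ^ n) * derivSup n u
      ≤ ((n : ℝ) + 1) ^ 2 / ((Nat.factorial n : ℝ) * R ^ n) * ∑ i, derivSup n (fun y => u y i) :=
        mul_le_mul_of_nonneg_left hD hw
    _ = ∑ i, dnorm n R (fun y => u y i) := by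
        rw [Finset.mul_sum]
        rfl

/-! ## §3 The binomial Leibniz bound -/

/-- **Binomial Leibniz bound for iterated partials of a product**: for smooth real `f`, `g` and a word
`l` of length `n`, `‖∂^l(fg)(y)‖ ≤ Σ_{k=0}^{n} C(n,k) · derivSup k f · derivSup (n−k) g`
(induction on `n`: `∂^{l'i}(fg) = ∂^{l'}(f ∂ᵢg) + ∂^{l'}(∂ᵢf g)` and Pascal's rule).
[cite: ArmstrongVicol2025, App. A Lemma 7.1 (proof)] -/
theorem norm_iterPartialDeriv_mul_le_sum :
    ∀ (n : ℕ) {f g : UnitAddTorus d → ℝ}, IsSmooth f → IsSmooth g → ∀ l : List d, l.length = n →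
      ∀ y, ‖iterPartialDeriv l (fun y => f y * g y) y‖ ≤
        ∑ k ∈ Finset.range (n + 1), (n.choose k : ℝ) * (derivSup k f * derivSup (n - k) g) := by
  intro n
  induction n with
  | zero =>
    intro f g hf hg l hl y
    have hl0 : l = [] := List.eq_nil_of_length_eq_zero hl
    subst hl0
    simp only [iterPartialDeriv_nil, zero_add, Finset.sum_range_one, Nat.choose_self, Nat.cast_one, one_mul,
      Nat.sub_zero, norm_mul]
    exact mul_le_mul (norm_le_derivSup_zero hf y) (norm_le_derivSup_zero hg y) (norm_nonneg _) (derivSup_nonneg _ _)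
  | succ n ih =>
    intro f g hf hg l hl y
    obtain ⟨l', i, rfl, hlen'⟩ := List.exists_eq_concat_of_length_eq_succ hl
    rw [iterPartialDeriv_concat]
    have h1f : IsContDiff 1 f := hf.isContDiff (by simp)
    have h1g : IsContDiff 1 g := hg.isContDiff (by simp)
    have hprod : Torus.partialDeriv i (fun y => f y * g y) =
        fun y => f y * Torus.partialDeriv i g y + Torus.partialDeriv i f y * g y :=
      funext fun y => partialDeriv_mul h1f h1g i y
    have hA : IsSmooth fun y => f y * Torus.partialDeriv i g y :=
      (ContDiff.mul hf (hg.partialDeriv i) : IsSmooth fun y => f y * Torus.partialDeriv i g y)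
    have hB : IsSmooth fun y => Torus.partialDeriv i f y * g y :=
      (ContDiff.mul (hf.partialDeriv i) hg : IsSmooth fun y => Torus.partialDeriv i f y * g y)
    rw [hprod, iterPartialDeriv_add hA hB l']
    have e1 := ih hf (hg.partialDeriv i) l' hlen' y
    have e2 := ih (hf.partialDeriv i) hg l' hlen' y
    -- shift the derivative inside `derivSup`
    have s1 : ∑ k ∈ Finset.range (n + 1), (n.choose k : ℝ) * (derivSup k f * derivSup (n - k) (Torus.partialDeriv i g)) ≤
        ∑ k ∈ Finset.range (n + 1), (n.choose k : ℝ) * (derivSup k f * derivSup (n + 1 - k) g) := by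
      refine Finset.sum_le_sum fun k hk => mul_le_mul_of_nonneg_left
        (mul_le_mul_of_nonneg_left ?_ (derivSup_nonneg _ _)) (Nat.cast_nonneg _)
      have hk' : k ≤ n := Nat.lt_succ_iff.1 (Finset.mem_range.1 hk)
      have e : n + 1 - k = (n - k) + 1 := by omega
      rw [e]
      exact derivSup_partialDeriv_le hg i (n - k)
    have s2 : ∑ k ∈ Finset.range (n + 1), (n.choose k : ℝ) * (derivSup k (Torus.partialDeriv i f) * derivSup (n - k) g) ≤
        ∑ k ∈ Finset.range (n + 1), (n.choose k : ℝ) * (derivSup (k + 1) f * derivSup (n - k) g) :=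
      Finset.sum_le_sum fun k _ => mul_le_mul_of_nonneg_left
        (mul_le_mul_of_nonneg_right (derivSup_partialDeriv_le hf i k) (derivSup_nonneg _ _)) (Nat.cast_nonneg _)
    rw [Finset.sum_choose_succ_mul (fun k m => derivSup k f * derivSup m g) n]
    exact (norm_add_le _ _).trans (add_le_add (e1.trans s1) (e2.trans s2))

/-- **Binomial Leibniz bound for `derivSup`**: `derivSup n (fg) ≤ Σₖ C(n,k) derivSup k f · derivSup (n−k) g`.
[cite: ArmstrongVicol2025, App. A Lemma 7.1 (proof)] -/
theorem derivSup_mul_le_sum (n : ℕ) {f g : UnitAddTorus d → ℝ} (hf : IsSmooth f) (hg : IsSmooth g) :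
    derivSup n (fun y => f y * g y) ≤
      ∑ k ∈ Finset.range (n + 1), (n.choose k : ℝ) * (derivSup k f * derivSup (n - k) g) :=
  derivSup_le (Finset.sum_nonneg fun _ _ => mul_nonneg (Nat.cast_nonneg _)
    (mul_nonneg (derivSup_nonneg _ _) (derivSup_nonneg _ _))) (norm_iterPartialDeriv_mul_le_sum n hf hg)

/-! ## §4 The product estimate (Armstrong–Vicol, App. A Lemma 7.1) -/

/-- **Product estimate, summed form** (the displayed inequality in the proof of Lemma 7.1): if
`⟦f⟧_{j,R} ≤ C_f` and `⟦g⟧_{j,R} ≤ C_g` for `j ≤ n` (`R > 0`), then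
`⟦fg⟧_{n,R} ≤ C_f C_g Σ_{k=0}^{n} (n+1)² / ((k+1)² (n−k+1)²)`.
[cite: ArmstrongVicol2025, App. A Lemma 7.1] -/
theorem dnorm_mul_le_sum {n : ℕ} {R Cf Cg : ℝ} {f g : UnitAddTorus d → ℝ} (hf : IsSmooth f) (hg : IsSmooth g)
    (hR : 0 < R) (hCf : ∀ j ≤ n, dnorm j R f ≤ Cf) (hCg : ∀ j ≤ n, dnorm j R g ≤ Cg) :
    dnorm n R (fun y => f y * g y) ≤
      Cf * Cg * ∑ k ∈ Finset.range (n + 1), ((n : ℝ) + 1) ^ 2 / ((((k : ℝ) + 1) ^ 2) * (((n - k : ℕ) : ℝ) + 1) ^ 2) := by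
  have hCf0 : 0 ≤ Cf := (dnorm_nonneg 0 hR.le f).trans (hCf 0 (Nat.zero_le _))
  have hCg0 : 0 ≤ Cg := (dnorm_nonneg 0 hR.le g).trans (hCg 0 (Nat.zero_le _))
  -- `derivSup k f ≤ Cf k! R^k/(k+1)²`, `derivSup (n-k) g ≤ Cg (n-k)! R^{n-k}/(n-k+1)²`
  have hDf : ∀ k ≤ n, derivSup k f ≤ Cf * ((Nat.factorial k : ℝ) * R ^ k) / ((k : ℝ) + 1) ^ 2 := fun k hk =>
    derivSup_le (by positivity) fun l hl y => norm_iterPartialDeriv_le_of_dnorm_le hf hR (hCf k hk) hl y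
  have hDg : ∀ k ≤ n, derivSup k g ≤ Cg * ((Nat.factorial k : ℝ) * R ^ k) / ((k : ℝ) + 1) ^ 2 := fun k hk =>
    derivSup_le (by positivity) fun l hl y => norm_iterPartialDeriv_le_of_dnorm_le hg hR (hCg k hk) hl y
  have hw := dnorm_weight_pos n hR
  rw [dnorm_def]
  have step1 : derivSup n (fun y => f y * g y) ≤ ∑ k ∈ Finset.range (n + 1), (n.choose k : ℝ) *
      ((Cf * ((Nat.factorial k : ℝ) * R ^ k) / ((k : ℝ) + 1) ^ 2) *
        (Cg * ((Nat.factorial (n - k) : ℝ) * R ^ (n - k)) / (((n - k : ℕ) : ℝ) + 1) ^ 2)) := by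
    refine (derivSup_mul_le_sum n hf hg).trans (Finset.sum_le_sum fun k hk => ?_)
    have hk' : k ≤ n := Nat.lt_succ_iff.1 (Finset.mem_range.1 hk)
    exact mul_le_mul_of_nonneg_left (mul_le_mul (hDf k hk') (hDg (n - k) (Nat.sub_le n k))
      (derivSup_nonneg _ _) (by positivity)) (Nat.cast_nonneg _)
  refine (mul_le_mul_of_nonneg_left step1 hw.le).trans (le_of_eq ?_)
  rw [Finset.mul_sum, Finset.mul_sum]
  refine Finset.sum_congr rfl fun k hk => ?_
  have hk' : k ≤ n := Nat.lt_succ_iff.1 (Finset.mem_range.1 hk)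
  have hchoose : (n.choose k : ℝ) * (Nat.factorial k : ℝ) * (Nat.factorial (n - k) : ℝ) = (Nat.factorial n : ℝ) := by
    exact_mod_cast Nat.choose_mul_factorial_mul_factorial hk'
  have hpow : R ^ k * R ^ (n - k) = R ^ n := by rw [← pow_add, Nat.add_sub_cancel' hk']
  have hfk : (Nat.factorial k : ℝ) ≠ 0 := by exact_mod_cast (Nat.factorial_pos k).ne'
  have hfnk : (Nat.factorial (n - k) : ℝ) ≠ 0 := by exact_mod_cast (Nat.factorial_pos (n - k)).ne'
  have hfn : (Nat.factorial n : ℝ) ≠ 0 := by exact_mod_cast (Nat.factorial_pos n).ne'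
  have hRk : R ^ k ≠ 0 := pow_ne_zero _ hR.ne'
  have hRnk : R ^ (n - k) ≠ 0 := pow_ne_zero _ hR.ne'
  have hRn : R ^ n ≠ 0 := pow_ne_zero _ hR.ne'
  have hk1 : ((k : ℝ) + 1) ^ 2 ≠ 0 := by positivity
  have hnk1 : (((n - k : ℕ) : ℝ) + 1) ^ 2 ≠ 0 := by positivity
  -- pure algebra: `(n+1)²/(n! Rⁿ) · C(n,k) · [Cf k! R^k/(k+1)²] · [Cg (n-k)! R^{n-k}/(n-k+1)²] = Cf Cg (n+1)²/((k+1)²(n-k+1)²)`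
  rw [div_mul_eq_mul_div, div_eq_iff (mul_ne_zero hfn hRn)]
  rw [show Cf * Cg * (((n : ℝ) + 1) ^ 2 / (((k : ℝ) + 1) ^ 2 * (((n - k : ℕ) : ℝ) + 1) ^ 2)) *
      ((Nat.factorial n : ℝ) * R ^ n) =
      Cf * Cg * ((n : ℝ) + 1) ^ 2 * ((n.choose k : ℝ) * (Nat.factorial k : ℝ) * (Nat.factorial (n - k) : ℝ)) *
        (R ^ k * R ^ (n - k)) / (((k : ℝ) + 1) ^ 2 * (((n - k : ℕ) : ℝ) + 1) ^ 2) by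
    rw [hchoose, hpow]; ring]
  field_simp

/-- `Σ_{i=1}^{N} 1/i² ≤ 2` (telescoping `1/(i+1)² ≤ 1/i − 1/(i+1)`). [folklore] -/
private theorem sum_inv_sq_succ_le_two (N : ℕ) : ∑ i ∈ Finset.range N, 1 / (((i : ℝ) + 1) ^ 2) ≤ 2 := by
  -- `S_{N+1} ≤ 2 - 1/(N+1)`
  have key : ∀ N : ℕ, ∑ i ∈ Finset.range (N + 1), 1 / (((i : ℝ) + 1) ^ 2) ≤ 2 - 1 / ((N : ℝ) + 1) := by
    intro N
    induction N with
    | zero => norm_num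
    | succ N ih =>
      rw [Finset.sum_range_succ]
      have hN : (0 : ℝ) < (N : ℝ) + 1 := by positivity
      have hN1 : (0 : ℝ) < (N : ℝ) + 1 + 1 := by positivity
      push_cast
      -- `1/(N+2)² ≤ 1/(N+1) - 1/(N+2)`
      have h1 : 1 / ((N : ℝ) + 1 + 1) ^ 2 ≤ 1 / ((N : ℝ) + 1) - 1 / ((N : ℝ) + 1 + 1) := by
        rw [div_sub_div _ _ hN.ne' hN1.ne', div_le_div_iff₀ (by positivity) (by positivity)]
        nlinarith
      linarith [ih, h1]
  cases N with
  | zero => norm_num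
  | succ N =>
    refine (key N).trans ?_
    have : (0 : ℝ) ≤ 1 / ((N : ℝ) + 1) := by positivity
    linarith

/-- **The numerical factor**: `Σ_{k=0}^{n} (n+1)²/((k+1)²(n−k+1)²) ≤ 8` (partial fractions
`(n+1)/((k+1)(n−k+1)) ≤ 1/(k+1) + 1/(n−k+1)` and `Σ 1/i² ≤ 2`; the sharp value is `≈ 3.52`,
Armstrong–Vicol use `4`). [cite: ArmstrongVicol2025, App. A Lemma 7.1 (proof)] -/
theorem sum_weight_le_eight (n : ℕ) :
    ∑ k ∈ Finset.range (n + 1), ((n : ℝ) + 1) ^ 2 / ((((k : ℝ) + 1) ^ 2) * (((n - k : ℕ) : ℝ) + 1) ^ 2) ≤ 8 := by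
  have hterm : ∀ k ∈ Finset.range (n + 1),
      ((n : ℝ) + 1) ^ 2 / ((((k : ℝ) + 1) ^ 2) * (((n - k : ℕ) : ℝ) + 1) ^ 2) ≤
        2 * (1 / ((k : ℝ) + 1) ^ 2) + 2 * (1 / (((n - k : ℕ) : ℝ) + 1) ^ 2) := by
    intro k hk
    have hk' : k ≤ n := Nat.lt_succ_iff.1 (Finset.mem_range.1 hk)
    have hcast : (((n - k : ℕ) : ℝ)) = (n : ℝ) - (k : ℝ) := by rw [Nat.cast_sub hk']
    set a : ℝ := (k : ℝ) + 1 with ha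
    set b : ℝ := ((n - k : ℕ) : ℝ) + 1 with hb
    have ha0 : 0 < a := by positivity
    have hb0 : 0 < b := by positivity
    have hab : (n : ℝ) + 1 ≤ a + b := by rw [ha, hb, hcast]; linarith
    -- `(n+1)/(ab) ≤ (a+b)/(ab) = 1/a + 1/b`, then `(x+y)² ≤ 2x² + 2y²`
    have h1 : ((n : ℝ) + 1) ^ 2 / (a ^ 2 * b ^ 2) ≤ (1 / a + 1 / b) ^ 2 := by
      have e : (1 / a + 1 / b) ^ 2 = (a + b) ^ 2 / (a ^ 2 * b ^ 2) := by
        field_simp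
        ring
      rw [e]
      exact div_le_div_of_nonneg_right (pow_le_pow_left₀ (by positivity) hab 2) (by positivity)
    calc ((n : ℝ) + 1) ^ 2 / (a ^ 2 * b ^ 2) ≤ (1 / a + 1 / b) ^ 2 := h1
      _ ≤ 2 * (1 / a) ^ 2 + 2 * (1 / b) ^ 2 := by nlinarith [sq_nonneg (1 / a - 1 / b)]
      _ = 2 * (1 / a ^ 2) + 2 * (1 / b ^ 2) := by rw [one_div_pow, one_div_pow]
  refine (Finset.sum_le_sum hterm).trans ?_
  rw [Finset.sum_add_distrib, ← Finset.mul_sum, ← Finset.mul_sum]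
  have hA := sum_inv_sq_succ_le_two (n + 1)
  -- the second sum is the first one read backwards
  have hB : ∑ k ∈ Finset.range (n + 1), 1 / (((n - k : ℕ) : ℝ) + 1) ^ 2 =
      ∑ k ∈ Finset.range (n + 1), 1 / ((k : ℝ) + 1) ^ 2 := by
    rw [← Finset.sum_range_reflect]
    refine Finset.sum_congr rfl fun k hk => ?_
    have hk' : k ≤ n := Nat.lt_succ_iff.1 (Finset.mem_range.1 hk)
    have e : n - (n + 1 - 1 - k) = k := by omega
    simp only [e]
  rw [hB]
  linarith

/-- **Product estimate** (Armstrong–Vicol, App. A Lemma 7.1): if `⟦f⟧_{j,R} ≤ C_f` and `⟦g⟧_{j,R} ≤ C_g`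
for all `j ≤ n` (`R > 0`), then `⟦fg⟧_{n,R} ≤ 8 C_f C_g` — the analyticity class is an algebra with a
universal constant (Armstrong–Vicol state the constant `4`; see `sum_weight_le_eight`).
[cite: ArmstrongVicol2025, App. A Lemma 7.1] -/
theorem dnorm_mul_le {n : ℕ} {R Cf Cg : ℝ} {f g : UnitAddTorus d → ℝ} (hf : IsSmooth f) (hg : IsSmooth g)
    (hR : 0 < R) (hCf : ∀ j ≤ n, dnorm j R f ≤ Cf) (hCg : ∀ j ≤ n, dnorm j R g ≤ Cg) :
    dnorm n R (fun y => f y * g y) ≤ 8 * Cf * Cg := by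
  have hCf0 : 0 ≤ Cf := (dnorm_nonneg 0 hR.le f).trans (hCf 0 (Nat.zero_le _))
  have hCg0 : 0 ≤ Cg := (dnorm_nonneg 0 hR.le g).trans (hCg 0 (Nat.zero_le _))
  refine (dnorm_mul_le_sum hf hg hR hCf hCg).trans ?_
  calc Cf * Cg * ∑ k ∈ Finset.range (n + 1), ((n : ℝ) + 1) ^ 2 / ((((k : ℝ) + 1) ^ 2) * (((n - k : ℕ) : ℝ) + 1) ^ 2)
      ≤ Cf * Cg * 8 := mul_le_mul_of_nonneg_left (sum_weight_le_eight n) (mul_nonneg hCf0 hCg0)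
    _ = 8 * Cf * Cg := by ring

/-! ## §5 The product estimate for a scalar times a vector field (`f • g`) -/

/-- **Binomial Leibniz bound for `f • g`** (`f` real, `g` vector-valued, both smooth): for a word `l`
of length `n`, `‖∂^l(f g)(y)‖ ≤ Σ_{k=0}^{n} C(n,k) · derivSup k f · derivSup (n−k) g`.
[cite: ArmstrongVicol2025, App. A Lemma 7.1 (proof)] -/
theorem norm_iterPartialDeriv_smul_le_sum :
    ∀ (n : ℕ) {f : UnitAddTorus d → ℝ} {g : UnitAddTorus d → F}, IsSmooth f → IsSmooth g → ∀ l : List d,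
      l.length = n → ∀ y, ‖iterPartialDeriv l (fun y => f y • g y) y‖ ≤
        ∑ k ∈ Finset.range (n + 1), (n.choose k : ℝ) * (derivSup k f * derivSup (n - k) g) := by
  intro n
  induction n with
  | zero =>
    intro f g hf hg l hl y
    have hl0 : l = [] := List.eq_nil_of_length_eq_zero hl
    subst hl0
    simp only [iterPartialDeriv_nil, zero_add, Finset.sum_range_one, Nat.choose_self, Nat.cast_one, one_mul,
      Nat.sub_zero, norm_smul]
    exact mul_le_mul (norm_le_derivSup_zero hf y) (norm_le_derivSup_zero hg y) (norm_nonneg _) (derivSup_nonneg _ _)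
  | succ n ih =>
    intro f g hf hg l hl y
    obtain ⟨l', i, rfl, hlen'⟩ := List.exists_eq_concat_of_length_eq_succ hl
    rw [iterPartialDeriv_concat]
    have h1f : IsContDiff 1 f := hf.isContDiff (by simp)
    have h1g : IsContDiff 1 g := hg.isContDiff (by simp)
    have hprod : Torus.partialDeriv i (fun y => f y • g y) =
        fun y => f y • Torus.partialDeriv i g y + Torus.partialDeriv i f y • g y :=
      funext fun y => partialDeriv_smul h1f h1g i y
    have hA : IsSmooth fun y => f y • Torus.partialDeriv i g y := hf.smul' (hg.partialDeriv i)
    have hB : IsSmooth fun y => Torus.partialDeriv i f y • g y := (hf.partialDeriv i).smul' hg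
    rw [hprod, iterPartialDeriv_add hA hB l']
    have e1 := ih hf (hg.partialDeriv i) l' hlen' y
    have e2 := ih (hf.partialDeriv i) hg l' hlen' y
    have s1 : ∑ k ∈ Finset.range (n + 1), (n.choose k : ℝ) * (derivSup k f * derivSup (n - k) (Torus.partialDeriv i g)) ≤
        ∑ k ∈ Finset.range (n + 1), (n.choose k : ℝ) * (derivSup k f * derivSup (n + 1 - k) g) := by
      refine Finset.sum_le_sum fun k hk => mul_le_mul_of_nonneg_left
        (mul_le_mul_of_nonneg_left ?_ (derivSup_nonneg _ _)) (Nat.cast_nonneg _)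
      have hk' : k ≤ n := Nat.lt_succ_iff.1 (Finset.mem_range.1 hk)
      have e : n + 1 - k = (n - k) + 1 := by omega
      rw [e]
      exact derivSup_partialDeriv_le hg i (n - k)
    have s2 : ∑ k ∈ Finset.range (n + 1), (n.choose k : ℝ) * (derivSup k (Torus.partialDeriv i f) * derivSup (n - k) g) ≤
        ∑ k ∈ Finset.range (n + 1), (n.choose k : ℝ) * (derivSup (k + 1) f * derivSup (n - k) g) :=
      Finset.sum_le_sum fun k _ => mul_le_mul_of_nonneg_left
        (mul_le_mul_of_nonneg_right (derivSup_partialDeriv_le hf i k) (derivSup_nonneg _ _)) (Nat.cast_nonneg _)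
    rw [Finset.sum_choose_succ_mul (fun k m => derivSup k f * derivSup m g) n]
    exact (norm_add_le _ _).trans (add_le_add (e1.trans s1) (e2.trans s2))

/-- **Product estimate for `f • g`, summed form**: `⟦f g⟧_{n,R} ≤ C_f C_g Σ_{k=0}^{n} (n+1)²/((k+1)²(n−k+1)²)`
given `⟦f⟧_{j,R} ≤ C_f`, `⟦g⟧_{j,R} ≤ C_g` for `j ≤ n` (`f` real, `g` vector-valued, `R > 0`).
[cite: ArmstrongVicol2025, App. A Lemma 7.1] -/
theorem dnorm_smul_le_sum {n : ℕ} {R Cf Cg : ℝ} {f : UnitAddTorus d → ℝ} {g : UnitAddTorus d → F}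
    (hf : IsSmooth f) (hg : IsSmooth g) (hR : 0 < R) (hCf : ∀ j ≤ n, dnorm j R f ≤ Cf)
    (hCg : ∀ j ≤ n, dnorm j R g ≤ Cg) :
    dnorm n R (fun y => f y • g y) ≤
      Cf * Cg * ∑ k ∈ Finset.range (n + 1), ((n : ℝ) + 1) ^ 2 / ((((k : ℝ) + 1) ^ 2) * (((n - k : ℕ) : ℝ) + 1) ^ 2) := by
  have hCf0 : 0 ≤ Cf := (dnorm_nonneg 0 hR.le f).trans (hCf 0 (Nat.zero_le _))
  have hCg0 : 0 ≤ Cg := (dnorm_nonneg 0 hR.le g).trans (hCg 0 (Nat.zero_le _))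
  have hDf : ∀ k ≤ n, derivSup k f ≤ Cf * ((Nat.factorial k : ℝ) * R ^ k) / ((k : ℝ) + 1) ^ 2 := fun k hk =>
    derivSup_le (by positivity) fun l hl y => norm_iterPartialDeriv_le_of_dnorm_le hf hR (hCf k hk) hl y
  have hDg : ∀ k ≤ n, derivSup k g ≤ Cg * ((Nat.factorial k : ℝ) * R ^ k) / ((k : ℝ) + 1) ^ 2 := fun k hk =>
    derivSup_le (by positivity) fun l hl y => norm_iterPartialDeriv_le_of_dnorm_le hg hR (hCg k hk) hl y
  have hw := dnorm_weight_pos n hR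
  have hD : derivSup n (fun y => f y • g y) ≤
      ∑ k ∈ Finset.range (n + 1), (n.choose k : ℝ) * (derivSup k f * derivSup (n - k) g) :=
    derivSup_le (Finset.sum_nonneg fun _ _ => mul_nonneg (Nat.cast_nonneg _)
      (mul_nonneg (derivSup_nonneg _ _) (derivSup_nonneg _ _))) (norm_iterPartialDeriv_smul_le_sum n hf hg)
  rw [dnorm_def]
  have step1 : derivSup n (fun y => f y • g y) ≤ ∑ k ∈ Finset.range (n + 1), (n.choose k : ℝ) *
      ((Cf * ((Nat.factorial k : ℝ) * R ^ k) / ((k : ℝ) + 1) ^ 2) *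
        (Cg * ((Nat.factorial (n - k) : ℝ) * R ^ (n - k)) / (((n - k : ℕ) : ℝ) + 1) ^ 2)) := by
    refine hD.trans (Finset.sum_le_sum fun k hk => ?_)
    have hk' : k ≤ n := Nat.lt_succ_iff.1 (Finset.mem_range.1 hk)
    exact mul_le_mul_of_nonneg_left (mul_le_mul (hDf k hk') (hDg (n - k) (Nat.sub_le n k))
      (derivSup_nonneg _ _) (by positivity)) (Nat.cast_nonneg _)
  refine (mul_le_mul_of_nonneg_left step1 hw.le).trans (le_of_eq ?_)
  rw [Finset.mul_sum, Finset.mul_sum]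
  refine Finset.sum_congr rfl fun k hk => ?_
  have hk' : k ≤ n := Nat.lt_succ_iff.1 (Finset.mem_range.1 hk)
  have hchoose : (n.choose k : ℝ) * (Nat.factorial k : ℝ) * (Nat.factorial (n - k) : ℝ) = (Nat.factorial n : ℝ) := by
    exact_mod_cast Nat.choose_mul_factorial_mul_factorial hk'
  have hpow : R ^ k * R ^ (n - k) = R ^ n := by rw [← pow_add, Nat.add_sub_cancel' hk']
  have hfk : (Nat.factorial k : ℝ) ≠ 0 := by exact_mod_cast (Nat.factorial_pos k).ne'
  have hfnk : (Nat.factorial (n - k) : ℝ) ≠ 0 := by exact_mod_cast (Nat.factorial_pos (n - k)).ne'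
  have hfn : (Nat.factorial n : ℝ) ≠ 0 := by exact_mod_cast (Nat.factorial_pos n).ne'
  have hRk : R ^ k ≠ 0 := pow_ne_zero _ hR.ne'
  have hRnk : R ^ (n - k) ≠ 0 := pow_ne_zero _ hR.ne'
  have hRn : R ^ n ≠ 0 := pow_ne_zero _ hR.ne'
  have hk1 : ((k : ℝ) + 1) ^ 2 ≠ 0 := by positivity
  have hnk1 : (((n - k : ℕ) : ℝ) + 1) ^ 2 ≠ 0 := by positivity
  rw [div_mul_eq_mul_div, div_eq_iff (mul_ne_zero hfn hRn)]
  rw [show Cf * Cg * (((n : ℝ) + 1) ^ 2 / (((k : ℝ) + 1) ^ 2 * (((n - k : ℕ) : ℝ) + 1) ^ 2)) *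
      ((Nat.factorial n : ℝ) * R ^ n) =
      Cf * Cg * ((n : ℝ) + 1) ^ 2 * ((n.choose k : ℝ) * (Nat.factorial k : ℝ) * (Nat.factorial (n - k) : ℝ)) *
        (R ^ k * R ^ (n - k)) / (((k : ℝ) + 1) ^ 2 * (((n - k : ℕ) : ℝ) + 1) ^ 2) by
    rw [hchoose, hpow]; ring]
  field_simp

/-- **Product estimate for `f • g`** (Armstrong–Vicol, App. A Lemma 7.1, scalar times vector):
`⟦f g⟧_{n,R} ≤ 8 C_f C_g` given `⟦f⟧_{j,R} ≤ C_f`, `⟦g⟧_{j,R} ≤ C_g` for `j ≤ n` (`R > 0`).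
[cite: ArmstrongVicol2025, App. A Lemma 7.1] -/
theorem dnorm_smul_le {n : ℕ} {R Cf Cg : ℝ} {f : UnitAddTorus d → ℝ} {g : UnitAddTorus d → F}
    (hf : IsSmooth f) (hg : IsSmooth g) (hR : 0 < R) (hCf : ∀ j ≤ n, dnorm j R f ≤ Cf)
    (hCg : ∀ j ≤ n, dnorm j R g ≤ Cg) :
    dnorm n R (fun y => f y • g y) ≤ 8 * Cf * Cg := by
  have hCf0 : 0 ≤ Cf := (dnorm_nonneg 0 hR.le f).trans (hCf 0 (Nat.zero_le _))
  have hCg0 : 0 ≤ Cg := (dnorm_nonneg 0 hR.le g).trans (hCg 0 (Nat.zero_le _))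
  refine (dnorm_smul_le_sum hf hg hR hCf hCg).trans ?_
  calc Cf * Cg * ∑ k ∈ Finset.range (n + 1), ((n : ℝ) + 1) ^ 2 / ((((k : ℝ) + 1) ^ 2) * (((n - k : ℕ) : ℝ) + 1) ^ 2)
      ≤ Cf * Cg * 8 := mul_le_mul_of_nonneg_left (sum_weight_le_eight n) (mul_nonneg hCf0 hCg0)
    _ = 8 * Cf * Cg := by ring

end Torus

end Literature.Analysis.FunctionSpaces

end
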